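import Literature.Algebra.Homology.KunnethZeroDifferential
import Mathlib.Algebra.Homology.Monoidal
import Mathlib.Algebra.Category.ModuleCat.Monoidal.Closed
import Mathlib.Algebra.Category.ModuleCat.Abelian
import Mathlib.Algebra.Category.ModuleCat.Colimits
import Mathlib.RingTheory.Flat.CategoryTheory
import Mathlib.CategoryTheory.Monoidal.Preadditive
import Mathlib.CategoryTheory.Limits.Preserves.Shapes.Kernels
import HarnessLib

/-!
# The Künneth map `Hⁱ(C) ⊗ Hʲ(D) → Hⁱ⁺ʲ(C ⊗ D)` (cross product in homology) for complexes of modules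

Layer `Literature/Algebra/Homology` (pure homological algebra over Mathlib; definitions = the canonical maps, 0 named
facts, no instances, no notation). For cochain complexes `C`, `D` of modules over a commutative ring `R` (Mathlib's
monoidal structure `HomologicalComplex.tensorObj` on `CochainComplex (ModuleCat R) ℤ`), the CANONICAL map of the Künneth
theorem (Weibel, *An introduction to homological algebra*, Thm. 3.6.3: "the cross product `⊕_{p+q=n} H_p(P) ⊗ H_q(Q) →
H_n(P ⊗ Q)`, `[z] ⊗ [w] ↦ [z ⊗ w]`"; Cartan–Eilenberg VI.3): a cycle `z ∈ Zⁱ(C)` and a cycle `w ∈ Zʲ(D)` give the cycle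
`z ⊗ w` of `(C ⊗ D)ⁿ`, `n = i + j`, whose class only depends on the classes of `z` and `w`.

* `cyclesTensorι C D i j n h : Zⁱ(C) ⊗ Zʲ(D) ⟶ (C ⊗ D)ⁿ` — `(ι ⊗ ι) ≫ ι_{i,j}`; it is killed by the differential
  (`cyclesTensorι_d`), whence `cyclesTensorToHomology : Zⁱ(C) ⊗ Zʲ(D) ⟶ Hⁿ(C ⊗ D)`;
* `toCycles_whiskerRight_cyclesTensorToHomology` / `whiskerLeft_toCycles_cyclesTensorToHomology` — it kills
  `Bⁱ(C) ⊗ Zʲ(D)` and `Zⁱ(C) ⊗ Bʲ(D)` (`dx ⊗ w = ±d(x ⊗ w)`, `z ⊗ dy = ±d(z ⊗ y)`);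
* **`kunnethComponent C D i j n h : Hⁱ(C) ⊗ Hʲ(D) ⟶ Hⁿ(C ⊗ D)`** — the descent through the two cokernels
  `Zⁱ ⊗ Zʲ → Hⁱ ⊗ Zʲ → Hⁱ ⊗ Hʲ` (`⊗` is right exact in each variable; Mathlib `HomologicalComplex.homologyIsCokernel`),
  characterised by **`homologyπ_tensor_kunnethComponent : (π ⊗ π) ≫ κᵢⱼ = cyclesTensorToHomology`**;
* **`kunnethMap C D n : ((H•(C), 0) ⊗ (H•(D), 0))ⁿ = ∐_{i+j=n} Hⁱ(C) ⊗ Hʲ(D) ⟶ Hⁿ(C ⊗ D)`** — the sum of the components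
  over the summands of Mathlib's total-complex coproduct (`HomologicalComplex.mapBifunctorDesc`), the source being the
  degree-`n` term of the tensor product of the homology complexes with ZERO differentials
  (`KunnethZeroDifferential.zeroDifferential`), `ι_kunnethMap`.

Naturality and the theorem that `kunnethMap` is an isomorphism over a field are in the sequel
`Algebra/Homology/KunnethMapIso`. Everything here is a construction with a body or a proved lemma; no named fact.
Library only (cell `pub-hodge-ring2`, count-neutral homological algebra; proves nothing about any crux, route or conjecture).

## References

* C. A. Weibel, *An introduction to homological algebra* (1994), Thm. 3.6.3 (Künneth formula for complexes; the cross
  product). [Weibel1994]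
* H. Cartan, S. Eilenberg, *Homological Algebra* (1956), VI.3, Thm. 3.1 and IV.6 (the map `α`). [CartanEilenberg1956]
-/

noncomputable section

-- `GradedObject`/`HomologicalComplex₂.toGradedObject` are not reducible (as in Mathlib's `Algebra/Homology/TotalComplex.lean`).
set_option backward.isDefEq.respectTransparency false

open CategoryTheory CategoryTheory.Category CategoryTheory.Limits CategoryTheory.MonoidalCategory HomologicalComplex

universe u

namespace Literature.Algebra.Homology

variable {R : Type u} [CommRing R] (C D : CochainComplex (ModuleCat.{u} R) ℤ)

/-! ### §1 Right exactness of `⊗` in each variable (the cokernel presentations of `Hⁱ ⊗ Zʲ`, `Hⁱ ⊗ Hʲ`) -/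

section Exactness

variable (M : ModuleCat.{u} R)

/-- `– ⊗ M` preserves finite colimits in `ModuleCat R` (it is isomorphic to `M ⊗ –`, a left adjoint).
[cite: Weibel1994, Thm. 3.6.3 (proof) and 2.6.] -/
theorem preservesFiniteColimits_tensorRight : PreservesFiniteColimits (tensorRight M) :=
  preservesFiniteColimits_of_natIso (BraidedCategory.tensorLeftIsoTensorRight M)

/-- `M ⊗ –` preserves finite colimits in `ModuleCat R` (a left adjoint). [cite: Weibel1994, Thm. 3.6.3 (proof) and 2.6] -/
theorem preservesFiniteColimits_tensorLeft : PreservesFiniteColimits (tensorLeft M) :=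
  inferInstance

/-- **`Hⁱ(C) ⊗ M` is the cokernel of `Cⁱ⁻¹ ⊗ M → Zⁱ(C) ⊗ M`** (`⊗ M` applied to the cokernel presentation
`Cⁱ⁻¹ → Zⁱ → Hⁱ → 0`, Mathlib `homologyIsCokernel`). [cite: Weibel1994, Thm. 3.6.3 (proof)] -/
def isColimitHomologyTensor (i : ℤ) :
    IsColimit ((CokernelCofork.ofπ (C.homologyπ i) (C.toCycles_comp_homologyπ (i - 1) i)).map (tensorRight M)) :=
  haveI := preservesFiniteColimits_tensorRight M
  (CokernelCofork.ofπ (C.homologyπ i) (C.toCycles_comp_homologyπ (i - 1) i)).mapIsColimit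
    (C.homologyIsCokernel (i - 1) i (by simp)) (tensorRight M)

/-- **`M ⊗ Hʲ(D)` is the cokernel of `M ⊗ Dʲ⁻¹ → M ⊗ Zʲ(D)`**. [cite: Weibel1994, Thm. 3.6.3 (proof)] -/
def isColimitTensorHomology (j : ℤ) :
    IsColimit ((CokernelCofork.ofπ (D.homologyπ j) (D.toCycles_comp_homologyπ (j - 1) j)).map (tensorLeft M)) :=
  haveI := preservesFiniteColimits_tensorLeft M
  (CokernelCofork.ofπ (D.homologyπ j) (D.toCycles_comp_homologyπ (j - 1) j)).mapIsColimit
    (D.homologyIsCokernel (j - 1) j (by simp)) (tensorLeft M)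

end Exactness

/-! ### §2 The cycle `z ⊗ w` and its class -/

section Cycles

variable (i j n : ℤ) (h : i + j = n)

/-- `Zⁱ(C) ⊗ Zʲ(D) ⟶ (C ⊗ D)ⁿ`, `z ⊗ w ↦ z ⊗ w` (in the summand `Cⁱ ⊗ Dʲ` of `(C ⊗ D)ⁿ`, `n = i + j`).
[cite: Weibel1994, Thm. 3.6.3] [cite: CartanEilenberg1956, IV.6] -/
def cyclesTensorι : C.cycles i ⊗ D.cycles j ⟶ (HomologicalComplex.tensorObj C D).X n :=
  (C.iCycles i ⊗ₘ D.iCycles j) ≫ ιTensorObj C D i j n h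

variable {i j n}

/-- The differential of `C ⊗ D` on the summand `Cⁱ ⊗ Dʲ`: `d(x ⊗ y) = ε₁ • dx ⊗ y + ε₂ • x ⊗ dy` (Mathlib's Koszul signs
`ε₁`, `ε₂` of the total complex), with free names for the target indices. [cite: Weibel1994, 2.7.1 and Thm. 3.6.3] -/
theorem ιTensorObj_d {i' j' n' : ℤ} (hi : i + 1 = i') (hj : j + 1 = j') (hn : n + 1 = n') :
    ιTensorObj C D i j n h ≫ (HomologicalComplex.tensorObj C D).d n n' =
      ComplexShape.ε₁ (ComplexShape.up ℤ) (ComplexShape.up ℤ) (ComplexShape.up ℤ) (i, j) •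
          ((C.d i i' ▷ D.X j) ≫ ιTensorObj C D i' j n' (by omega)) +
        ComplexShape.ε₂ (ComplexShape.up ℤ) (ComplexShape.up ℤ) (ComplexShape.up ℤ) (i, j) •
          ((C.X i ◁ D.d j j') ≫ ιTensorObj C D i j' n' (by omega)) := by
  rw [mapBifunctor.d_eq, Preadditive.comp_add, mapBifunctor.ι_D₁, mapBifunctor.ι_D₂,
    mapBifunctor.d₁_eq C D (curriedTensor _) _ (show (ComplexShape.up ℤ).Rel i i' from hi) j n'
      (by change i' + j = n'; omega),
    mapBifunctor.d₂_eq C D (curriedTensor _) _ i (show (ComplexShape.up ℤ).Rel j j' from hj) n'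
      (by change i + j' = n'; omega)]
  rfl

variable (i j n)

/-- **`z ⊗ w` is a cycle**: `(ι ⊗ ι) ≫ ι_{i,j} ≫ d = 0` (`dz = 0`, `dw = 0`). [cite: Weibel1994, Thm. 3.6.3] -/
theorem cyclesTensorι_d : cyclesTensorι C D i j n h ≫ (HomologicalComplex.tensorObj C D).d n (n + 1) = 0 := by
  rw [cyclesTensorι, assoc, ιTensorObj_d C D h rfl rfl rfl, Preadditive.comp_add, Linear.comp_units_smul,
    Linear.comp_units_smul, ← tensorHom_id, ← id_tensorHom, tensorHom_comp_tensorHom_assoc,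
    tensorHom_comp_tensorHom_assoc, iCycles_d, iCycles_d, MonoidalPreadditive.zero_tensor,
    MonoidalPreadditive.tensor_zero, zero_comp, zero_comp, smul_zero, smul_zero, add_zero]

/-- `Zⁱ(C) ⊗ Zʲ(D) ⟶ Zⁿ(C ⊗ D)`, `z ⊗ w ↦ z ⊗ w`. [cite: Weibel1994, Thm. 3.6.3] -/
def cyclesTensorToCycles : C.cycles i ⊗ D.cycles j ⟶ (HomologicalComplex.tensorObj C D).cycles n :=
  (HomologicalComplex.tensorObj C D).liftCycles (cyclesTensorι C D i j n h) (n + 1) (by simp) (cyclesTensorι_d C D i j n h)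

/-- `cyclesTensorToCycles ≫ ι = cyclesTensorι`. [cite: Weibel1994, Thm. 3.6.3] -/
@[reassoc (attr := simp)]
theorem cyclesTensorToCycles_i :
    cyclesTensorToCycles C D i j n h ≫ (HomologicalComplex.tensorObj C D).iCycles n = cyclesTensorι C D i j n h :=
  liftCycles_i _ _ _ _ _

/-- **`Zⁱ(C) ⊗ Zʲ(D) ⟶ Hⁿ(C ⊗ D)`, `z ⊗ w ↦ [z ⊗ w]`.** [cite: Weibel1994, Thm. 3.6.3] [cite: CartanEilenberg1956, IV.6] -/
def cyclesTensorToHomology : C.cycles i ⊗ D.cycles j ⟶ (HomologicalComplex.tensorObj C D).homology n :=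
  cyclesTensorToCycles C D i j n h ≫ (HomologicalComplex.tensorObj C D).homologyπ n

/-- Precomposing `liftCycles` with a morphism. [folklore] -/
private theorem comp_liftCycles {A B : ModuleCat.{u} R} (K : CochainComplex (ModuleCat.{u} R) ℤ) (g : A ⟶ B) {m : ℤ}
    (k : B ⟶ K.X m) (hk : k ≫ K.d m (m + 1) = 0) :
    g ≫ K.liftCycles k (m + 1) (by simp) hk =
      K.liftCycles (g ≫ k) (m + 1) (by simp) (by rw [assoc, hk, comp_zero]) := by
  rw [← cancel_mono (K.iCycles m), assoc, liftCycles_i, liftCycles_i]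

variable {i j n}

/-- **`dx ⊗ w` is a boundary**: `[dx ⊗ w] = 0` for a cycle `w` — the map `z ⊗ w ↦ [z ⊗ w]` kills `Bⁱ(C) ⊗ Zʲ(D)`:
`(toCycles ▷ Zʲ) ≫ cyclesTensorToHomology = 0` (`dx ⊗ w = ε₁⁻¹ • d(x ⊗ w)` since `dw = 0`).
[cite: Weibel1994, Thm. 3.6.3 (proof)] -/
theorem toCycles_whiskerRight_cyclesTensorToHomology {i₀ : ℤ} (hi : i₀ + 1 = i) :
    (C.toCycles i₀ i ▷ D.cycles j) ≫ cyclesTensorToHomology C D i j n h = 0 := by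
  -- the boundary witness `x ⊗ w ↦ ε₁⁻¹ • (x ⊗ w)` in the summand `(i₀, j)` of degree `n - 1`
  let ε := ComplexShape.ε₁ (ComplexShape.up ℤ) (ComplexShape.up ℤ) (ComplexShape.up ℤ) (i₀, j)
  have lhs : (C.toCycles i₀ i ▷ D.cycles j) ≫ cyclesTensorι C D i j n h =
      (C.X i₀ ◁ D.iCycles j) ≫ (C.d i₀ i ▷ D.X j) ≫ ιTensorObj C D i j n h := by
    rw [cyclesTensorι, ← tensorHom_id, tensorHom_comp_tensorHom_assoc, toCycles_i, id_comp, tensorHom_def'_assoc]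
  have rhs : (ε⁻¹ • ((C.X i₀ ◁ D.iCycles j) ≫ ιTensorObj C D i₀ j (n - 1) (by omega))) ≫
        (HomologicalComplex.tensorObj C D).d (n - 1) n =
      (C.X i₀ ◁ D.iCycles j) ≫ (C.d i₀ i ▷ D.X j) ≫ ιTensorObj C D i j n h := by
    rw [Linear.units_smul_comp, assoc, ιTensorObj_d C D (by omega) hi rfl (by omega), Preadditive.comp_add,
      Linear.comp_units_smul, Linear.comp_units_smul, ← MonoidalCategory.whiskerLeft_comp_assoc, iCycles_d,
      MonoidalPreadditive.whiskerLeft_zero, zero_comp, smul_zero, add_zero, smul_smul, inv_mul_cancel, one_smul]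
  rw [cyclesTensorToHomology, ← assoc, cyclesTensorToCycles, comp_liftCycles]
  exact (HomologicalComplex.tensorObj C D).liftCycles_homologyπ_eq_zero_of_boundary _ (n + 1) (by simp) _ (lhs.trans rhs.symm)

/-- **`z ⊗ dy` is a boundary**: the map `z ⊗ w ↦ [z ⊗ w]` kills `Zⁱ(C) ⊗ Bʲ(D)`:
`(Zⁱ ◁ toCycles) ≫ cyclesTensorToHomology = 0` (`z ⊗ dy = ε₂⁻¹ • d(z ⊗ y)` since `dz = 0`).
[cite: Weibel1994, Thm. 3.6.3 (proof)] -/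
theorem whiskerLeft_toCycles_cyclesTensorToHomology {j₀ : ℤ} (hj : j₀ + 1 = j) :
    (C.cycles i ◁ D.toCycles j₀ j) ≫ cyclesTensorToHomology C D i j n h = 0 := by
  let ε := ComplexShape.ε₂ (ComplexShape.up ℤ) (ComplexShape.up ℤ) (ComplexShape.up ℤ) (i, j₀)
  have lhs : (C.cycles i ◁ D.toCycles j₀ j) ≫ cyclesTensorι C D i j n h =
      (C.iCycles i ▷ D.X j₀) ≫ (C.X i ◁ D.d j₀ j) ≫ ιTensorObj C D i j n h := by
    rw [cyclesTensorι, ← id_tensorHom, tensorHom_comp_tensorHom_assoc, toCycles_i, id_comp, tensorHom_def_assoc]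
  have rhs : (ε⁻¹ • ((C.iCycles i ▷ D.X j₀) ≫ ιTensorObj C D i j₀ (n - 1) (by omega))) ≫
        (HomologicalComplex.tensorObj C D).d (n - 1) n =
      (C.iCycles i ▷ D.X j₀) ≫ (C.X i ◁ D.d j₀ j) ≫ ιTensorObj C D i j n h := by
    rw [Linear.units_smul_comp, assoc, ιTensorObj_d C D (by omega) rfl hj (by omega), Preadditive.comp_add,
      Linear.comp_units_smul, Linear.comp_units_smul, ← comp_whiskerRight_assoc, iCycles_d,
      MonoidalPreadditive.zero_whiskerRight, zero_comp, smul_zero, zero_add, smul_smul, inv_mul_cancel, one_smul]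
  rw [cyclesTensorToHomology, ← assoc, cyclesTensorToCycles, comp_liftCycles]
  exact (HomologicalComplex.tensorObj C D).liftCycles_homologyπ_eq_zero_of_boundary _ (n + 1) (by simp) _ (lhs.trans rhs.symm)

end Cycles

/-! ### §3 Descent to `Hⁱ(C) ⊗ Hʲ(D)`: the Künneth component -/

section Descent

variable (i j n : ℤ) (h : i + j = n)

/-- First descent: `Hⁱ(C) ⊗ Zʲ(D) ⟶ Hⁿ(C ⊗ D)`, through the cokernel `Cⁱ⁻¹ ⊗ Zʲ → Zⁱ ⊗ Zʲ → Hⁱ ⊗ Zʲ → 0`.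
[cite: Weibel1994, Thm. 3.6.3 (proof)] -/
def homologyTensorCyclesDesc : C.homology i ⊗ D.cycles j ⟶ (HomologicalComplex.tensorObj C D).homology n :=
  Cofork.IsColimit.desc (isColimitHomologyTensor C (D.cycles j) i) (cyclesTensorToHomology C D i j n h)
    (by
      rw [zero_comp]
      exact toCycles_whiskerRight_cyclesTensorToHomology C D h (by omega))

/-- `(π ▷ Zʲ) ≫ homologyTensorCyclesDesc = cyclesTensorToHomology`. [cite: Weibel1994, Thm. 3.6.3 (proof)] -/
@[reassoc (attr := simp)]
theorem homologyπ_whiskerRight_homologyTensorCyclesDesc :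
    (C.homologyπ i ▷ D.cycles j) ≫ homologyTensorCyclesDesc C D i j n h = cyclesTensorToHomology C D i j n h :=
  Cofork.IsColimit.π_desc' (isColimitHomologyTensor C (D.cycles j) i) _ _

/-- The first descent still kills `Hⁱ(C) ⊗ Bʲ(D)`. [cite: Weibel1994, Thm. 3.6.3 (proof)] -/
theorem whiskerLeft_toCycles_homologyTensorCyclesDesc {j₀ : ℤ} (hj : j₀ + 1 = j) :
    (C.homology i ◁ D.toCycles j₀ j) ≫ homologyTensorCyclesDesc C D i j n h = 0 := by
  apply Cofork.IsColimit.hom_ext (isColimitHomologyTensor C (D.X j₀) i)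
  rw [CokernelCofork.map_π, comp_zero]
  change (C.homologyπ i ▷ D.X j₀) ≫ (C.homology i ◁ D.toCycles j₀ j) ≫ homologyTensorCyclesDesc C D i j n h = 0
  rw [← whisker_exchange_assoc]
  change (C.cycles i ◁ D.toCycles j₀ j) ≫ (C.homologyπ i ▷ D.cycles j) ≫ homologyTensorCyclesDesc C D i j n h = 0
  rw [homologyπ_whiskerRight_homologyTensorCyclesDesc]
  exact whiskerLeft_toCycles_cyclesTensorToHomology C D h hj

/-- **The Künneth component `κᵢⱼ : Hⁱ(C) ⊗ Hʲ(D) ⟶ Hⁱ⁺ʲ(C ⊗ D)`, `[z] ⊗ [w] ↦ [z ⊗ w]`** (second descent, through the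
cokernel `Hⁱ ⊗ Dʲ⁻¹ → Hⁱ ⊗ Zʲ → Hⁱ ⊗ Hʲ → 0`). [cite: Weibel1994, Thm. 3.6.3] [cite: CartanEilenberg1956, VI.3 Thm. 3.1] -/
def kunnethComponent : C.homology i ⊗ D.homology j ⟶ (HomologicalComplex.tensorObj C D).homology n :=
  Cofork.IsColimit.desc (isColimitTensorHomology D (C.homology i) j) (homologyTensorCyclesDesc C D i j n h)
    (by
      rw [zero_comp]
      exact whiskerLeft_toCycles_homologyTensorCyclesDesc C D i j n h (by omega))

/-- `(Hⁱ ◁ π) ≫ κᵢⱼ = homologyTensorCyclesDesc`. [cite: Weibel1994, Thm. 3.6.3] -/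
@[reassoc (attr := simp)]
theorem whiskerLeft_homologyπ_kunnethComponent :
    (C.homology i ◁ D.homologyπ j) ≫ kunnethComponent C D i j n h = homologyTensorCyclesDesc C D i j n h :=
  Cofork.IsColimit.π_desc' (isColimitTensorHomology D (C.homology i) j) _ _

/-- **The defining property of the Künneth component**: `(π ⊗ π) ≫ κᵢⱼ = (z ⊗ w ↦ [z ⊗ w])`.
[cite: Weibel1994, Thm. 3.6.3] [cite: CartanEilenberg1956, VI.3 Thm. 3.1] -/
@[reassoc]
theorem homologyπ_tensor_kunnethComponent :
    (C.homologyπ i ⊗ₘ D.homologyπ j) ≫ kunnethComponent C D i j n h = cyclesTensorToHomology C D i j n h := by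
  rw [tensorHom_def, assoc, whiskerLeft_homologyπ_kunnethComponent, homologyπ_whiskerRight_homologyTensorCyclesDesc]

/-- **Uniqueness**: a map `Hⁱ ⊗ Hʲ ⟶ A` is determined by its precomposition with `π ⊗ π` (`π ⊗ π` is an epimorphism,
both `⊗ Zʲ` and `Hⁱ ⊗` being right exact). [cite: Weibel1994, Thm. 3.6.3 (proof)] -/
theorem hom_ext_homologyπ_tensor {A : ModuleCat.{u} R} {f g : C.homology i ⊗ D.homology j ⟶ A}
    (hfg : (C.homologyπ i ⊗ₘ D.homologyπ j) ≫ f = (C.homologyπ i ⊗ₘ D.homologyπ j) ≫ g) : f = g := by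
  apply Cofork.IsColimit.hom_ext (isColimitTensorHomology D (C.homology i) j)
  apply Cofork.IsColimit.hom_ext (isColimitHomologyTensor C (D.cycles j) i)
  rw [CokernelCofork.map_π, CokernelCofork.map_π]
  change (C.homologyπ i ▷ D.cycles j) ≫ (C.homology i ◁ D.homologyπ j) ≫ f =
    (C.homologyπ i ▷ D.cycles j) ≫ (C.homology i ◁ D.homologyπ j) ≫ g
  rw [← tensorHom_def_assoc, ← tensorHom_def_assoc]
  exact hfg

end Descent

/-! ### §4 The Künneth map on `∐_{i+j=n} Hⁱ(C) ⊗ Hʲ(D)` -/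

section Total

/-- The complex `(H•(C), 0)` of the homology of `C` with zero differentials (the tree's `zeroDifferential`).
[cite: Weibel1994, Thm. 3.6.3] -/
abbrev homologyZeroDifferential : CochainComplex (ModuleCat.{u} R) ℤ :=
  zeroDifferential (ComplexShape.up ℤ) (fun i => C.homology i)

/-- **The Künneth map `κₙ : ((H•(C), 0) ⊗ (H•(D), 0))ⁿ = ∐_{i+j=n} Hⁱ(C) ⊗ Hʲ(D) ⟶ Hⁿ(C ⊗ D)`**, the sum of the
components `κᵢⱼ` over Mathlib's total-complex coproduct. [cite: Weibel1994, Thm. 3.6.3] [cite: CartanEilenberg1956, VI.3 Thm. 3.1] -/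
def kunnethMap (n : ℤ) :
    (HomologicalComplex.tensorObj (homologyZeroDifferential C) (homologyZeroDifferential D)).X n ⟶ (HomologicalComplex.tensorObj C D).homology n :=
  mapBifunctorDesc (fun i j (hij : ComplexShape.π (ComplexShape.up ℤ) (ComplexShape.up ℤ) (ComplexShape.up ℤ) (i, j) = n) =>
    kunnethComponent C D i j n hij)

/-- On the summand `Hⁱ(C) ⊗ Hʲ(D)` the Künneth map is the component `κᵢⱼ`. [cite: Weibel1994, Thm. 3.6.3] -/
@[reassoc (attr := simp)]
theorem ι_kunnethMap (i j n : ℤ) (h : i + j = n) :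
    ιTensorObj (homologyZeroDifferential C) (homologyZeroDifferential D) i j n h ≫ kunnethMap C D n =
      kunnethComponent C D i j n h :=
  HomologicalComplex.ι_mapBifunctorDesc _ _ _ _

end Total

end Literature.Algebra.Homology

end
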